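import Literature.NumberTheory.LFunctions.DobnerSelbergClassProofs
import Literature.NumberTheory.LFunctions.DobnerLemma1Proofs
import Literature.NumberTheory.LFunctions.MertensBoundRH
import Literature.NumberTheory.LFunctions.SelbergClassConvexityBound
import Mathlib.Analysis.SpecialFunctions.Gaussian.FourierTransform
import Mathlib.MeasureTheory.Integral.Prod
import Mathlib.MeasureTheory.Measure.Haar.NormedSpace
import HarnessLib

/-!
# The extended Selberg class `𝒮♯`: polynomial growth in vertical strips, and Dobner's eq. (3.1)

RH-FREE real/complex analysis about Kaczorowski–Perelli's extended Selberg class `𝒮♯`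
(`Literature.NumberTheory.LFunctions.ExtendedSelbergDatum`, Dobner 2021 §2 (i)–(iii)); cell
rh-crit, corpus C3 (Rodgers–Tao/Dobner), seat t4, in support of the `𝒮♯`-general form of Dobner's
Theorem 2 (architecture note of seat t7, item "S#-convexity port", input of N0 = eq. (3.1)).
Proofs only: NO definition, NO named fact. Everything is the port to `ExtendedSelbergDatum` of the
tree's `SelbergDatum` files `SelbergClassProofs.lean` (functional equation cross-multiplied),
`SelbergClassDegreeBounds.lean` (pole-free functional equation, `‖F‖` on `Re s < 1`) and
`SelbergClassConvexityBound.lean` (growth on far-left lines, Rademacher–Phragmén–Lindelöf), with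
`λⱼ ↦ ωᵢ`, the root number replaced by `conj α / α`, and Dobner's polar factor `sᵐ (s−1)ᵐ` carried
through (it cancels in modulus):

* `ExtendedSelbergDatum.functional_equation_conj` — (iii) with the conjugation pushed inside:
  `α sᵐ(s−1)ᵐ Qˢ ∏Γ(ωᵢs+μᵢ) F(s) = ᾱ (1−s)ᵐ(−s)ᵐ Q^{1−s} ∏Γ(ωᵢ(1−s)+μ̄ᵢ) conj F(1−s̄)` on the strip.
* `ExtendedSelbergDatum.fe_prod_inv_Gamma_of_ne` — the functional equation in the pole-free
  `1/Γ`-form on all of `ℂ ∖ {0, 1}` (identity theorem: both sides times the inverse Gamma products,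
  written through the entire continuation `G` of `(s−1)ᵐF`, are entire).
* `ExtendedSelbergDatum.norm_toFun_eq_of_re_lt_one` —
  `‖F(s)‖ = Q^{1−2σ} ∏ᵢ ‖Γ(ωᵢ(1−s)+μ̄ᵢ)‖·‖Γ(ωᵢs+μᵢ)⁻¹‖ · ‖F(1−s̄)‖` for `Re s < 1`, `s ≠ 0`.
* `ExtendedSelbergDatum.bddAbove_norm_toFun_image_re_ge` — `F` bounded on `Re s ≥ 3/2` ((i)).
* `ExtendedSelbergDatum.norm_toFun_mul_norm_sub_one_pow_le` — **the convexity bound**: for all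
  `σ₁ ≤ σ₂` there are `C, A` with `‖F(s)‖‖s−1‖ᵐ ≤ C (1 + |Im s|)^A` on `σ₁ ≤ Re s ≤ σ₂`, `s ≠ 1`;
  `ExtendedSelbergDatum.norm_toFun_le_mul_abs_im_rpow` — its printed form
  `‖F(σ+it)‖ ≤ C |t|^A` for `|t| ≥ 1`, uniformly in `σ₁ ≤ σ ≤ σ₂`.
  (The intermediate steps — boundedness constant, growth on far-left lines, the `(s−1)ᵐF` form —
  are `private` ports of the `SelbergDatum` lemmas of the same names.)

This is the standard "polynomial growth in vertical strips" of `𝒮♯` (Kaczorowski–Perelli 1999,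
§2; only axioms (i)–(iii) are used, no Ramanujan bound and no Euler product — exactly as the
`SelbergDatum` proofs, which never touched (iv)–(v)).

## Part II (appended): Dobner's eq. (3.1) for `𝒮♯`

For `k ≥ 1` and `t < 0` the deformation `ξ^F_t` (`ExtendedSelbergDatum.xiDeformed`, defined through
`Φ_F` and `H_t`) is a Gaussian average of `ξ^F` over a vertical line:

* `ExtendedSelbergDatum.exists_norm_xi_le_exp_neg` — `‖ξ^F(s)‖ ≤ M e^{−K|Im s|}` on
  `½ ≤ Re s ≤ 2`, `s ≠ 1` (Dobner's Lemma 1 `dobner_lemma1_holds` × Part I's polynomial growth of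
  `F`; p. 6 "the integrand decays exponentially");
* `ExtendedSelbergDatum.integrable_xi_critical_line` — hence `x ↦ ξ^F((1+ix)/2)` is integrable and
  `Φ_F` is a genuine Fourier transform;
* `ExtendedSelbergDatum.Ht_eq_integral_xi_gaussian` — `H_t(z) = (√(π/|t|)/2π) ∫ ξ^F((1+ix)/2)
  e^{−(z−x)²/(4|t|)} dx` (Fubini + the Gaussian Fourier integral `integral_cexp_quadratic`);
* `ExtendedSelbergDatum.xiDeformed_eq_integral_xi_critical_line` — eq. (3.1) on `Re w' = ½`;
* `ExtendedSelbergDatum.xiDeformed_eq_integral_xi_two` — **eq. (3.1) on the line `Re w' = 2`**,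
  `ξ^F_t(w) = (π|t|)^{−1/2} ∫ ξ^F(2+iv) e^{(w−2−iv)²/|t|} dv`, by Cauchy's theorem on rectangles
  (`MertensBoundRH.integral_vertical_eq_of_tendsto`) for the entire `ξ^F` of
  `ExtendedSelbergDatum.exists_entire_xi`; and the line bounds
  `ExtendedSelbergDatum.exists_norm_xi_two_le_exp` / `exists_norm_xi_two_le`.

This is the `𝒮♯`-form of the tree's `xiDeformed_eq_integral_riemannXi_two` (`F = ζ`,
`DobnerSteepestDescent.lean`), in the shape consumed by the `𝒮♯`-general Theorem 4 (cell plan,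
node N1-a).

## References

* J. Kaczorowski, A. Perelli, *The Selberg class: a survey*, in: Number theory in progress,
  Vol. 2 (Zakopane 1997), de Gruyter (1999), 953–992, §2. [KaczorowskiPerelli1999]
* A. Dobner, *A new proof of Newman's conjecture and a generalization*, arXiv:2005.05142
  (= Acta Arith. 201 (2021)), §2 pp. 5–6, Lemma 1, §3 eq. (3.1) p. 8. [Dobner2021]
* H. Rademacher, *On the Phragmén–Lindelöf theorem and some applications*, Math. Z. 72 (1959),
  Thm 2. [Rademacher1959]

LABEL: RH-FREE; bears_on N-C/N-P (COLUMN 3 DBN) only as infrastructure for Dobner's Theorem 2 in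
`𝒮♯`. WHAT THIS IS NOT: anything about the zeros of `ζ` or about `Λ`; nothing here bears on the
truth of RH.
-/

noncomputable section

open Complex Filter Topology Set Asymptotics Metric
open scoped ComplexConjugate

namespace Literature.NumberTheory.LFunctions

namespace ExtendedSelbergDatum

open Literature.Analysis.SpecialFunctions Literature.Analysis.Complex

variable (D : ExtendedSelbergDatum)

/-! ## The functional equation cross-multiplied and off the strip -/

/-- `Q ≠ 0` in `ℂ` (`Q > 0`). [cite: Dobner2021, §2 (iii) p. 5] -/
private theorem Q_cast_ne_zero : (D.Q : ℂ) ≠ 0 := Complex.ofReal_ne_zero.mpr D.Q_pos.ne'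

/-- The `Γ`-factors have no poles or zeros on the right half-plane: `Γ(ωᵢ s + μᵢ) ≠ 0` for
`Re s > 0` (`ωᵢ > 0`, `Re μᵢ ≥ 0`; p. 5 "the `Γ` function has no poles in the right half-plane").
[cite: Dobner2021, §2 p. 5] -/
theorem Gamma_omega_mul_add_mu_ne_zero (s : ℂ) (hs : 0 < s.re) (i : Fin D.numGamma) :
    Gamma (D.omega i * s + D.mu i) ≠ 0 := by
  apply Complex.Gamma_ne_zero_of_re_pos
  rw [SelbergDatum.re_lam_mul_add]
  have := D.omega_pos i
  have := D.mu_re_nonneg i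
  positivity

/-- `Γ(ωᵢ(1−s) + conj μᵢ) ≠ 0` for `Re s < 1`. [cite: Dobner2021, §2 p. 5] -/
theorem Gamma_omega_mul_one_sub_add_conj_mu_ne_zero (s : ℂ) (hs : s.re < 1)
    (i : Fin D.numGamma) : Gamma (D.omega i * (1 - s) + conj (D.mu i)) ≠ 0 := by
  apply Complex.Gamma_ne_zero_of_re_pos
  rw [SelbergDatum.re_lam_mul_add, Complex.conj_re, Complex.sub_re, Complex.one_re]
  have := D.omega_pos i
  have := D.mu_re_nonneg i
  nlinarith

/-- The functional equation (iii) with the conjugation pushed inside: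
`α sᵐ (s−1)ᵐ Qˢ ∏Γ(ωᵢ s + μᵢ) F(s) = conj α · (1−s)ᵐ (−s)ᵐ Q^{1−s} ∏Γ(ωᵢ(1−s) + conj μᵢ) · conj F(1−s̄)`
on the open strip (`Γ(z̄) = conj Γ(z)`, `Q^{z̄} = conj Q^z` for `Q > 0`). [cite: Dobner2021, §2 (iii) p. 5] -/
theorem functional_equation_conj (s : ℂ) (h0 : 0 < s.re) (h1 : s.re < 1) :
    D.alpha * s ^ D.polarOrder * (s - 1) ^ D.polarOrder * (D.Q : ℂ) ^ s *
        (∏ i, Gamma (D.omega i * s + D.mu i)) * D.toFun s =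
      conj D.alpha * (1 - s) ^ D.polarOrder * (-s) ^ D.polarOrder * (D.Q : ℂ) ^ (1 - s) *
        (∏ i, Gamma (D.omega i * (1 - s) + conj (D.mu i))) * conj (D.toFun (1 - conj s)) := by
  have hQ : conj ((D.Q : ℂ) ^ (1 - conj s)) = (D.Q : ℂ) ^ (1 - s) := by
    have harg : (D.Q : ℂ).arg ≠ Real.pi := by
      rw [Complex.arg_ofReal_of_nonneg D.Q_pos.le]; exact Real.pi_pos.ne
    rw [show (1 : ℂ) - conj s = conj (1 - s) by simp [map_sub], Complex.cpow_conj _ _ harg,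
      Complex.conj_conj, Complex.conj_ofReal]
  have hG : ∀ i, conj (Gamma (D.omega i * (1 - conj s) + D.mu i)) =
      Gamma (D.omega i * (1 - s) + conj (D.mu i)) := fun i ↦ by
    rw [← Complex.Gamma_conj]
    congr 1
    simp [map_sub, Complex.conj_ofReal]
  have h := D.functional_equation s h0 h1
  rw [dobnerGamma_apply, dobnerGamma_apply] at h
  rw [h]
  simp only [map_mul, map_pow, map_prod, hQ, hG, map_sub, map_one, Complex.conj_conj]
  ring

/-- **The functional equation in pole-free form on all of `ℂ ∖ {0, 1}`**:
`α sᵐ(s−1)ᵐ Qˢ P†(1−s) F(s) = conj α · (1−s)ᵐ(−s)ᵐ Q^{1−s} P(s) conj F(1−s̄)` with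
`P(s) = ∏ᵢ Γ(ωᵢ s + μᵢ)⁻¹`, `P†(w) = ∏ᵢ Γ(ωᵢ w + conj μᵢ)⁻¹` (entire). On the strip this is (iii)
times `P(s)P†(1−s)`; written through the entire continuation `G` of `(s−1)ᵐ F` ((ii)) both sides are
entire, so the identity theorem extends it. [cite: Dobner2021, §2 (ii)–(iii) p. 5] -/
theorem fe_prod_inv_Gamma_of_ne (s : ℂ) (h0 : s ≠ 0) (h1 : s ≠ 1) :
    D.alpha * s ^ D.polarOrder * (s - 1) ^ D.polarOrder * (D.Q : ℂ) ^ s *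
        (∏ i, (Gamma (D.omega i * (1 - s) + conj (D.mu i)))⁻¹) * D.toFun s =
      conj D.alpha * (1 - s) ^ D.polarOrder * (-s) ^ D.polarOrder * (D.Q : ℂ) ^ (1 - s) *
        (∏ i, (Gamma (D.omega i * s + D.mu i))⁻¹) * conj (D.toFun (1 - conj s)) := by
  obtain ⟨G, hG, hGF, -⟩ := D.differentiable
  -- the two entire functions
  set Λ₁ : ℂ → ℂ := fun s ↦ D.alpha * s ^ D.polarOrder * (D.Q : ℂ) ^ s *
    (∏ i, (Gamma (D.omega i * (1 - s) + conj (D.mu i)))⁻¹) * G s with hΛ₁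
  set Λ₂ : ℂ → ℂ := fun s ↦ conj D.alpha * (1 - s) ^ D.polarOrder * (D.Q : ℂ) ^ (1 - s) *
    (∏ i, (Gamma (D.omega i * s + D.mu i))⁻¹) * conj (G (1 - conj s)) with hΛ₂
  have hΛ₁d : Differentiable ℂ Λ₁ := by
    refine (((Differentiable.mul ?_ ?_).mul ?_).mul ?_).mul hG
    · exact differentiable_const _
    · exact differentiable_id.pow _
    · exact differentiable_id.const_cpow (Or.inl D.Q_cast_ne_zero)
    · exact (SelbergDatum.differentiable_prod_inv_Gamma D.omega fun i ↦ conj (D.mu i)).comp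
        ((differentiable_const _).sub differentiable_id)
  have hΛ₂d : Differentiable ℂ Λ₂ := by
    refine (((Differentiable.mul ?_ ?_).mul ?_).mul
      (SelbergDatum.differentiable_prod_inv_Gamma D.omega D.mu)).mul
      (SelbergDatum.differentiable_conj_comp_one_sub_conj hG)
    · exact differentiable_const _
    · exact ((differentiable_const _).sub differentiable_id).pow _
    · exact ((differentiable_const _).sub differentiable_id).const_cpow (Or.inl D.Q_cast_ne_zero)
  -- `conj (G (1 - conj s)) = (-s)^m conj F(1 - conj s)` for `s ≠ 0`
  have hGconj : ∀ s : ℂ, s ≠ 0 →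
      conj (G (1 - conj s)) = (-s) ^ D.polarOrder * conj (D.toFun (1 - conj s)) := by
    intro s hs
    have hne : 1 - conj s ≠ 1 := by
      intro h; apply hs
      have : conj s = 0 := by linear_combination -h
      simpa using congrArg conj this
    rw [hGF _ hne, map_mul, map_pow]
    congr 2
    simp
  -- they agree on the open strip
  have hstrip : ∀ s : ℂ, 0 < s.re → s.re < 1 → Λ₁ s = Λ₂ s := by
    intro s hs0 hs1
    have hs : s ≠ 0 := fun h ↦ by rw [h, Complex.zero_re] at hs0; exact lt_irrefl _ hs0
    have hs' : s ≠ 1 := fun h ↦ by rw [h, Complex.one_re] at hs1; exact lt_irrefl _ hs1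
    have FE := D.functional_equation_conj s hs0 hs1
    have u1 := SelbergDatum.prod_inv_Gamma_mul_prod_Gamma D.omega D.mu s
      (D.Gamma_omega_mul_add_mu_ne_zero s hs0)
    have u2 := SelbergDatum.prod_inv_Gamma_mul_prod_Gamma D.omega (fun i ↦ conj (D.mu i)) (1 - s)
      (D.Gamma_omega_mul_one_sub_add_conj_mu_ne_zero s hs1)
    simp only [hΛ₁, hΛ₂, hGF s hs', hGconj s hs]
    linear_combination
      ((∏ i, (Gamma (D.omega i * s + D.mu i))⁻¹) *
          ∏ i, (Gamma (D.omega i * (1 - s) + conj (D.mu i)))⁻¹) * FE -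
        (D.alpha * s ^ D.polarOrder * (D.Q : ℂ) ^ s *
          (∏ i, (Gamma (D.omega i * (1 - s) + conj (D.mu i)))⁻¹) *
            ((s - 1) ^ D.polarOrder * D.toFun s)) * u1 +
        (conj D.alpha * (1 - s) ^ D.polarOrder * (D.Q : ℂ) ^ (1 - s) *
          (∏ i, (Gamma (D.omega i * s + D.mu i))⁻¹) *
            ((-s) ^ D.polarOrder * conj (D.toFun (1 - conj s)))) * u2
  -- identity theorem
  have hall : Λ₁ = Λ₂ := by
    have hΦd : Differentiable ℂ (Λ₁ - Λ₂) := hΛ₁d.sub hΛ₂d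
    have hopen : IsOpen (Complex.re ⁻¹' Set.Ioo (0 : ℝ) 1) :=
      isOpen_Ioo.preimage Complex.continuous_re
    have hmem : (((1 / 2 : ℝ) : ℂ)) ∈ Complex.re ⁻¹' Set.Ioo (0 : ℝ) 1 := by
      simp only [Set.mem_preimage, Complex.ofReal_re, Set.mem_Ioo]; norm_num
    have key : (Λ₁ - Λ₂) =ᶠ[𝓝 (((1 / 2 : ℝ) : ℂ))] 0 := by
      filter_upwards [hopen.mem_nhds hmem] with s hs
      have hs' : 0 < s.re ∧ s.re < 1 := hs
      simp only [Pi.sub_apply, Pi.zero_apply, hstrip s hs'.1 hs'.2, sub_self]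
    have h0 : Λ₁ - Λ₂ = 0 := funext fun z ↦
      (Complex.analyticOnNhd_univ_iff_differentiable.mpr hΦd).eqOn_zero_of_preconnected_of_eventuallyEq_zero
        isPreconnected_univ (mem_univ _) key (mem_univ z)
    exact sub_eq_zero.1 h0
  -- evaluate at `s`
  have h := congrFun hall s
  simp only [hΛ₁, hΛ₂, hGF s h1, hGconj s h0] at h
  linear_combination h

/-- **`‖F(s)‖` on `Re s < 1` from the functional equation**: for `Re s < 1`, `s ≠ 0`,
`‖F(s)‖ = Q^{1−2σ} · ∏ᵢ (‖Γ(ωᵢ(1−s) + conj μᵢ)‖ · ‖Γ(ωᵢs + μᵢ)⁻¹‖) · ‖F(1 − s̄)‖` — the polar factor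
`sᵐ(s−1)ᵐ` and `α` cancel in modulus (`‖conj α‖ = ‖α‖`, `‖1−s‖ = ‖s−1‖`, `‖−s‖ = ‖s‖`).
[cite: Dobner2021, §2 (iii) p. 5] -/
theorem norm_toFun_eq_of_re_lt_one (s : ℂ) (h0 : s ≠ 0) (hs : s.re < 1) :
    ‖D.toFun s‖ = D.Q ^ (1 - 2 * s.re) *
      (∏ i, (‖Gamma (D.omega i * (1 - s) + conj (D.mu i))‖ *
        ‖(Gamma (D.omega i * s + D.mu i))⁻¹‖)) * ‖D.toFun (1 - conj s)‖ := by
  have h1 : s ≠ 1 := fun h ↦ by rw [h, Complex.one_re] at hs; exact lt_irrefl _ hs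
  have hfe := D.fe_prod_inv_Gamma_of_ne s h0 h1
  have hQs : (D.Q : ℂ) ^ s ≠ 0 := Complex.cpow_ne_zero_iff.2 (Or.inl D.Q_cast_ne_zero)
  have hΓ : ∀ i, Gamma (D.omega i * (1 - s) + conj (D.mu i)) ≠ 0 :=
    D.Gamma_omega_mul_one_sub_add_conj_mu_ne_zero s hs
  have hPd : ∏ i, (Gamma (D.omega i * (1 - s) + conj (D.mu i)))⁻¹ ≠ 0 :=
    SelbergDatum.prod_inv_Gamma_ne_zero D.omega (fun i ↦ conj (D.mu i)) (1 - s) hΓ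
  have hden : D.alpha * s ^ D.polarOrder * (s - 1) ^ D.polarOrder * (D.Q : ℂ) ^ s *
      (∏ i, (Gamma (D.omega i * (1 - s) + conj (D.mu i)))⁻¹) ≠ 0 :=
    mul_ne_zero (mul_ne_zero (mul_ne_zero (mul_ne_zero D.alpha_ne_zero (pow_ne_zero _ h0))
      (pow_ne_zero _ (sub_ne_zero.2 h1))) hQs) hPd
  have hF : D.toFun s = conj D.alpha * (1 - s) ^ D.polarOrder * (-s) ^ D.polarOrder *
      (D.Q : ℂ) ^ (1 - s) * (∏ i, (Gamma (D.omega i * s + D.mu i))⁻¹) *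
        conj (D.toFun (1 - conj s)) /
      (D.alpha * s ^ D.polarOrder * (s - 1) ^ D.polarOrder * (D.Q : ℂ) ^ s *
        ∏ i, (Gamma (D.omega i * (1 - s) + conj (D.mu i)))⁻¹) := by
    rw [eq_div_iff hden]
    linear_combination hfe
  rw [hF, norm_div]
  simp only [norm_mul, norm_pow, Complex.norm_conj, norm_neg,
    Complex.norm_cpow_eq_rpow_re_of_pos D.Q_pos, norm_prod, norm_inv, Finset.prod_mul_distrib]
  rw [norm_sub_rev (1 : ℂ) s]
  simp only [sub_re, one_re]
  have hpos : ∀ i, 0 < ‖Gamma (D.omega i * (1 - s) + conj (D.mu i))‖ :=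
    fun i ↦ norm_pos_iff.2 (hΓ i)
  have hPn : (∏ i, ‖Gamma (D.omega i * (1 - s) + conj (D.mu i))‖) ≠ 0 :=
    (Finset.prod_pos fun i _ ↦ hpos i).ne'
  have hQ : (D.Q ^ s.re : ℝ) ≠ 0 := (Real.rpow_pos_of_pos D.Q_pos _).ne'
  have hα : ‖D.alpha‖ ≠ 0 := norm_ne_zero_iff.2 D.alpha_ne_zero
  have hsn : ‖s‖ ^ D.polarOrder ≠ 0 := pow_ne_zero _ (norm_ne_zero_iff.2 h0)
  have hs1n : ‖s - 1‖ ^ D.polarOrder ≠ 0 := pow_ne_zero _ (norm_ne_zero_iff.2 (sub_ne_zero.2 h1))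
  rw [Finset.prod_inv_distrib (fun i ↦ ‖Gamma (D.omega i * (1 - s) + conj (D.mu i))‖),
    show (1 : ℝ) - 2 * s.re = (1 - s.re) - s.re by ring, Real.rpow_sub D.Q_pos (1 - s.re) s.re]
  generalize D.Q ^ s.re = q at hQ ⊢
  generalize D.Q ^ (1 - s.re) = q'
  generalize (∏ i, ‖Gamma (D.omega i * (1 - s) + conj (D.mu i))‖) = Pn at hPn ⊢
  generalize (∏ i, ‖Gamma (D.omega i * s + D.mu i)‖⁻¹) = Pd
  generalize ‖D.toFun (1 - conj s)‖ = f
  generalize ‖D.alpha‖ = a at hα ⊢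
  generalize ‖s‖ ^ D.polarOrder = b at hsn ⊢
  generalize ‖s - 1‖ ^ D.polarOrder = c at hs1n ⊢
  field_simp

/-! ## Boundedness on `Re s ≥ 3/2` -/

/-- `F` is bounded on `Re s ≥ 3/2` by `∑ |aₙ| n^{−3/2}` (absolute convergence, (i)).
[cite: Dobner2021, §2 (i) p. 5] -/
private theorem norm_toFun_le_tsum (s : ℂ) (hs : 3 / 2 ≤ s.re) :
    ‖D.toFun s‖ ≤ ∑' n : ℕ, ‖LSeries.term D.coeff ((3 / 2 : ℝ) : ℂ) n‖ := by
  have h1 : 1 < s.re := by linarith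
  have hsum : LSeriesSummable D.coeff ((3 / 2 : ℝ) : ℂ) := D.summable _ (by simp; norm_num)
  have hnorm : Summable fun n ↦ ‖LSeries.term D.coeff ((3 / 2 : ℝ) : ℂ) n‖ := summable_norm_iff.2 hsum
  have hle : ∀ n, ‖LSeries.term D.coeff s n‖ ≤ ‖LSeries.term D.coeff ((3 / 2 : ℝ) : ℂ) n‖ :=
    fun n ↦ LSeries.norm_term_le_of_re_le_re D.coeff (by simpa using hs) n
  have hnorm' : Summable fun n ↦ ‖LSeries.term D.coeff s n‖ :=
    .of_nonneg_of_le (fun n ↦ norm_nonneg _) hle hnorm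
  rw [D.eqOn_LSeries h1, LSeries]
  exact (norm_tsum_le_tsum_norm hnorm').trans (Summable.tsum_le_tsum hle hnorm' hnorm)

/-- `F` is bounded on `re s ≥ 3/2`: the constant `A₀ = ∑ |a(n)| n^{-3/2} + 1 > 0`. [cite: Dobner2021, §2 (i) p. 5] -/
private theorem exists_norm_toFun_le_of_re_ge :
    ∃ A₀ : ℝ, 0 < A₀ ∧ ∀ s : ℂ, 3 / 2 ≤ s.re → ‖D.toFun s‖ ≤ A₀ := by
  refine ⟨(∑' n : ℕ, ‖LSeries.term D.coeff ((3 / 2 : ℝ) : ℂ) n‖) + 1, ?_, fun s hs ↦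
    (D.norm_toFun_le_tsum s hs).trans (by linarith)⟩
  have : 0 ≤ ∑' n : ℕ, ‖LSeries.term D.coeff ((3 / 2 : ℝ) : ℂ) n‖ := tsum_nonneg fun n ↦ norm_nonneg _
  linarith

/-! ## Growth on far-left vertical lines -/

set_option maxHeartbeats 1000000 in
/-- **Polynomial growth of `F` on far-left vertical lines** (functional equation + the uniform
vertical Gamma-ratio bound `Literature.Analysis.SpecialFunctions.norm_Gamma_mul_norm_inv_Gamma_le`):
there is `κ₀ ≥ 2` such that for every `κ ≥ κ₀`, `‖F(1 − κ + it)‖ ≤ C_κ (1 + |t|)^{A_κ}` for all real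
`t`. (Stirling's formula would give `A_κ = d(κ − 1/2)`; any polynomial bound suffices here.)
[cite: KaczorowskiPerelli1999, §2] -/
private theorem exists_norm_toFun_left_line_le :
    ∃ κ₀ : ℝ, 2 ≤ κ₀ ∧ ∀ κ : ℝ, κ₀ ≤ κ → ∃ C A : ℝ, 0 < C ∧ 0 ≤ A ∧
      ∀ t : ℝ, ‖D.toFun (((1 - κ : ℝ) : ℂ) + t * I)‖ ≤ C * (1 + |t|) ^ A := by
  obtain ⟨A₀, hA₀, hFA₀⟩ := D.exists_norm_toFun_le_of_re_ge
  -- `Sμ = ∑ ‖μⱼ‖` dominates every `‖μⱼ‖`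
  obtain ⟨Sμ, hSμ⟩ : ∃ S : ℝ, ∑ j, ‖D.mu j‖ = S := ⟨_, rfl⟩
  have hSμ0 : 0 ≤ Sμ := by rw [← hSμ]; exact Finset.sum_nonneg fun j _ ↦ norm_nonneg _
  have hmuS : ∀ j, ‖D.mu j‖ ≤ Sμ := fun j ↦ by
    rw [← hSμ]
    exact Finset.single_le_sum (f := fun i ↦ ‖D.mu i‖) (fun i _ ↦ norm_nonneg _) (Finset.mem_univ j)
  -- `κ₀`: large enough that `λⱼ (κ - 1) ≥ 1 + ‖μⱼ‖` for all `j`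
  set κ₀ : ℝ := 2 + ∑ j, (1 + Sμ) / D.omega j with hκ₀
  have hκ₀2 : 2 ≤ κ₀ := by
    rw [hκ₀]
    have : 0 ≤ ∑ j, (1 + Sμ) / D.omega j :=
      Finset.sum_nonneg fun j _ ↦ div_nonneg (by linarith) (D.omega_pos j).le
    linarith
  refine ⟨κ₀, hκ₀2, fun κ hκ ↦ ?_⟩
  have hκ2 : 2 ≤ κ := hκ₀2.trans hκ
  have hkj : ∀ j, 1 + Sμ ≤ D.omega j * (κ - 1) := by
    intro j
    have hl := D.omega_pos j
    have h1 : (1 + Sμ) / D.omega j ≤ ∑ i, (1 + Sμ) / D.omega i :=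
      Finset.single_le_sum (f := fun i ↦ (1 + Sμ) / D.omega i)
        (fun i _ ↦ div_nonneg (by linarith) (D.omega_pos i).le) (Finset.mem_univ j)
    have h2 : (1 + Sμ) / D.omega j ≤ κ - 1 := by rw [hκ₀] at hκ; linarith
    rwa [div_le_iff₀ hl, mul_comm] at h2
  -- exponent and constant
  set Λ : ℝ := ∑ j, D.omega j with hΛ
  have hΛ0 : 0 ≤ Λ := Finset.sum_nonneg fun j _ ↦ (D.omega_pos j).le
  set A : ℝ := ∑ j, (D.omega j * (2 * κ - 1) + 2) with hA
  have hA0 : 0 ≤ A := Finset.sum_nonneg fun j _ ↦ by nlinarith [D.omega_pos j]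
  set β₀ : ℝ := 3 * Λ * κ + κ + 3 * Sμ + 4 with hβ₀
  have hΛκ0 : 0 ≤ Λ * κ := mul_nonneg hΛ0 (by linarith)
  have hβ₀1 : 1 ≤ β₀ := by rw [hβ₀]; nlinarith
  have hβ₀0 : 0 < β₀ := by linarith
  have hQ0 := D.Q_pos
  refine ⟨D.Q ^ (2 * κ - 1) * (120 * Real.pi ^ 2) ^ D.numGamma * β₀ ^ A * A₀, A,
    by positivity, hA0, fun t ↦ ?_⟩
  set σ : ℝ := 1 - κ with hσ
  set s : ℂ := (σ : ℂ) + t * I with hs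
  have hsre : s.re = σ := by simp [hs]
  have hsim : s.im = t := by simp [hs]
  have hs0 : s ≠ 0 := fun h ↦ by
    have := congrArg Complex.re h; rw [hsre, Complex.zero_re, hσ] at this; linarith
  have hs1 : s.re < 1 := by rw [hsre, hσ]; linarith
  rw [D.norm_toFun_eq_of_re_lt_one s hs0 hs1]
  -- (a) the power of `Q`
  have hQ : D.Q ^ (1 - 2 * s.re) = D.Q ^ (2 * κ - 1) := by rw [hsre, hσ]; ring_nf
  -- (b) `‖F(1 - conj s)‖ ≤ A₀`
  have hF1 : ‖D.toFun (1 - conj s)‖ ≤ A₀ := hFA₀ _ (by simp [hsre, hσ]; linarith)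
  -- (c) the Gamma ratios: `β = β₀ (1 + |t|)` dominates everything
  set β : ℝ := β₀ * (1 + |t|) with hβ
  have ht0 : 0 ≤ |t| := abs_nonneg t
  have hβ1 : 1 ≤ β := by rw [hβ]; nlinarith
  have hββ₀ : β₀ ≤ β := by rw [hβ]; nlinarith
  have hratio : ∀ j, ‖Gamma (D.omega j * (1 - s) + conj (D.mu j))‖ *
      ‖(Gamma (D.omega j * s + D.mu j))⁻¹‖ ≤ 120 * Real.pi ^ 2 * β ^ (D.omega j * (2 * κ - 1) + 2) := by
    intro j
    have hl := D.omega_pos j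
    have hμre := D.mu_re_nonneg j
    obtain ⟨X, hX⟩ : ∃ X : ℝ, D.omega j * κ + (D.mu j).re = X := ⟨_, rfl⟩
    obtain ⟨Y, hY⟩ : ∃ Y : ℝ, (D.mu j).re - D.omega j * (κ - 1) = Y := ⟨_, rfl⟩
    obtain ⟨u, hu⟩ : ∃ u : ℝ, D.omega j * t + (D.mu j).im = u := ⟨_, rfl⟩
    have hnum : (D.omega j : ℂ) * (1 - s) + conj (D.mu j) = conj ((X : ℂ) + u * I) := by
      apply Complex.ext
      · rw [SelbergDatum.re_lam_mul_add, Complex.sub_re, Complex.one_re, hsre, Complex.conj_re]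
        simp only [Complex.conj_re, Complex.add_re, Complex.ofReal_re, Complex.mul_re, Complex.I_re,
          Complex.ofReal_im, Complex.I_im, mul_zero, mul_one, sub_self, add_zero]
        rw [← hX, hσ]; ring
      · rw [SelbergDatum.im_lam_mul_add, Complex.sub_im, Complex.one_im, hsim, Complex.conj_im]
        simp only [Complex.conj_im, Complex.add_im, Complex.ofReal_im, Complex.mul_im, Complex.I_re,
          Complex.ofReal_re, Complex.I_im, mul_zero, mul_one, zero_add, add_zero]
        rw [← hu]; ring
    have hden : (D.omega j : ℂ) * s + D.mu j = (Y : ℂ) + u * I := by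
      apply Complex.ext
      · rw [SelbergDatum.re_lam_mul_add, hsre]
        simp only [Complex.add_re, Complex.ofReal_re, Complex.mul_re, Complex.I_re, Complex.ofReal_im,
          Complex.I_im, mul_zero, mul_one, sub_self, add_zero]
        rw [← hY, hσ]; ring
      · rw [SelbergDatum.im_lam_mul_add, hsim]
        simp only [Complex.add_im, Complex.ofReal_im, Complex.mul_im, Complex.I_re, Complex.ofReal_re,
          Complex.I_im, mul_zero, mul_one, zero_add, add_zero]
        rw [← hu]
    have hμ1 : |(D.mu j).im| ≤ ‖D.mu j‖ := Complex.abs_im_le_norm _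
    have hμ2 : |(D.mu j).re| ≤ ‖D.mu j‖ := Complex.abs_re_le_norm _
    have hμ3 := hmuS j
    have hX1 : 1 ≤ X := by
      rw [← hX]; nlinarith [hkj j, le_abs_self (D.mu j).re]
    have hY1 : Y ≤ 1 / 2 := by
      rw [← hY]; linarith [hkj j, le_abs_self (D.mu j).re, hμ2, hμ3]
    rw [hnum, Complex.Gamma_conj, Complex.norm_conj, hden]
    refine (norm_Gamma_mul_norm_inv_Gamma_le hX1 hY1 u).trans ?_
    have hu1 : |u| ≤ D.omega j * |t| + ‖D.mu j‖ := by
      rw [← hu]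
      refine (abs_add_le _ _).trans ?_
      rw [abs_mul, abs_of_pos hl]
      linarith
    have hlamΛ : D.omega j ≤ Λ :=
      Finset.single_le_sum (f := D.omega) (fun i _ ↦ (D.omega_pos i).le) (Finset.mem_univ j)
    have hlk : D.omega j * κ ≤ Λ * κ := mul_le_mul_of_nonneg_right hlamΛ (by linarith)
    have hlt : D.omega j * |t| ≤ Λ * κ * |t| :=
      mul_le_mul_of_nonneg_right (hlamΛ.trans (le_mul_of_one_le_right hΛ0 (by linarith))) ht0
    have hβexp : β = β₀ + β₀ * |t| := by rw [hβ]; ring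
    have hβ₀Λ : Λ * κ ≤ β₀ := by rw [hβ₀]; linarith
    have hΛt : Λ * κ * |t| ≤ β₀ * |t| := mul_le_mul_of_nonneg_right hβ₀Λ ht0
    have hb1 : 1 + |u| ≤ β := by rw [hβexp, hβ₀]; linarith
    have hXle : X ≤ Λ * κ + Sμ := by
      rw [← hX]; linarith [le_abs_self (D.mu j).re]
    have hYle : |Y| ≤ Λ * κ + Sμ := by
      rw [← hY, abs_le]; constructor
      · linarith [neg_abs_le (D.mu j).re]
      · linarith [le_abs_self (D.mu j).re]
    have hb2 : X + |Y| + 3 + |u| ≤ β := by rw [hβexp, hβ₀]; linarith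
    have hexp : X - Y + 1 / 2 = D.omega j * (2 * κ - 1) + 1 / 2 := by rw [← hX, ← hY]; ring
    rw [hexp]
    have hβ0 : 0 < β := by linarith
    have he0 : 0 ≤ D.omega j * (2 * κ - 1) + 1 / 2 := by nlinarith
    have hu0 : 0 ≤ 1 + |u| := by linarith [abs_nonneg u]
    have hv0 : 0 ≤ X + |Y| + 3 + |u| := by linarith [abs_nonneg Y, abs_nonneg u]
    have h1 : (1 + |u|) ^ (3 / 2 : ℝ) ≤ β ^ (3 / 2 : ℝ) := Real.rpow_le_rpow hu0 hb1 (by norm_num)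
    have h2 : (X + |Y| + 3 + |u|) ^ (D.omega j * (2 * κ - 1) + 1 / 2) ≤
        β ^ (D.omega j * (2 * κ - 1) + 1 / 2) := Real.rpow_le_rpow hv0 hb2 he0
    have hc0 : (0 : ℝ) ≤ 120 * Real.pi ^ 2 := by positivity
    have h3 : 120 * Real.pi ^ 2 * (1 + |u|) ^ (3 / 2 : ℝ) ≤ 120 * Real.pi ^ 2 * β ^ (3 / 2 : ℝ) :=
      mul_le_mul_of_nonneg_left h1 hc0
    have h4 : (0 : ℝ) ≤ 120 * Real.pi ^ 2 * β ^ (3 / 2 : ℝ) := mul_nonneg hc0 (Real.rpow_nonneg hβ0.le _)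
    have h5 := mul_le_mul h3 h2 (Real.rpow_nonneg hv0 _) h4
    refine h5.trans_eq ?_
    rw [mul_assoc, ← Real.rpow_add hβ0]
    congr 1; ring_nf
  have hprod : (∏ j, (‖Gamma (D.omega j * (1 - s) + conj (D.mu j))‖ *
      ‖(Gamma (D.omega j * s + D.mu j))⁻¹‖)) ≤ (120 * Real.pi ^ 2) ^ D.numGamma * β ^ A := by
    calc (∏ j, (‖Gamma (D.omega j * (1 - s) + conj (D.mu j))‖ * ‖(Gamma (D.omega j * s + D.mu j))⁻¹‖))
        ≤ ∏ j, (120 * Real.pi ^ 2 * β ^ (D.omega j * (2 * κ - 1) + 2)) :=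
          Finset.prod_le_prod (fun j _ ↦ by positivity) (fun j _ ↦ hratio j)
      _ = (120 * Real.pi ^ 2) ^ D.numGamma * β ^ A := by
          have hb0 : 0 < β := lt_of_lt_of_le one_pos hβ1
          have hpow : β ^ A = ∏ j, β ^ (D.omega j * (2 * κ - 1) + 2) := by
            rw [hA]; exact Real.rpow_sum_of_pos hb0 _ _
          rw [hpow, Finset.prod_mul_distrib, Finset.prod_const, Finset.card_univ, Fintype.card_fin]
  -- `β ^ A = β₀ ^ A (1 + |t|) ^ A`
  have hβA : β ^ A = β₀ ^ A * (1 + |t|) ^ A := by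
    rw [hβ, Real.mul_rpow (by linarith) (by linarith)]
  rw [hQ]
  have hP0 : 0 ≤ ∏ j, (‖Gamma (D.omega j * (1 - s) + conj (D.mu j))‖ * ‖(Gamma (D.omega j * s + D.mu j))⁻¹‖) :=
    Finset.prod_nonneg fun j _ ↦ by positivity
  have hQ0' : 0 ≤ D.Q ^ (2 * κ - 1) := Real.rpow_nonneg D.Q_pos.le _
  have step1 : D.Q ^ (2 * κ - 1) *
      (∏ j, (‖Gamma (D.omega j * (1 - s) + conj (D.mu j))‖ * ‖(Gamma (D.omega j * s + D.mu j))⁻¹‖)) *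
      ‖D.toFun (1 - conj s)‖ ≤
      D.Q ^ (2 * κ - 1) * ((120 * Real.pi ^ 2) ^ D.numGamma * β ^ A) * A₀ :=
    mul_le_mul (mul_le_mul_of_nonneg_left hprod hQ0') hF1 (norm_nonneg _)
      (mul_nonneg hQ0' (by positivity))
  refine step1.trans_eq ?_
  rw [hβA]; ring


/-! ## The convexity bound -/

/-- **The convexity bound: polynomial growth of `(s − 1)^m F(s)` in every vertical strip.** For
every `σ₁ ≤ σ₂` there are `C > 0`, `A ≥ 0` with `‖(s−1)^m F(s)‖ ≤ C (1 + |im s|)^A` whenever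
`σ₁ ≤ re s ≤ σ₂`, `s ≠ 1`: the Phragmén–Lindelöf principle in Rademacher's form
(`Literature.Analysis.Complex.rademacher_phragmenLindelof_of_finiteOrder`) applied to the entire
function `(s−1)^m F(s)` of finite order (axiom (ii)) on a wide strip `[1 − κ, κ]`, bounded
polynomially on the right edge by absolute convergence and on the left edge by the functional
equation (`exists_norm_toFun_left_line_le`). This is the standard "polynomial growth in vertical
strips" of elements of `𝒮` (Conrey–Ghosh 1993, §2; Kaczorowski–Perelli survey, §2).
[cite: KaczorowskiPerelli1999, §2] -/
private theorem exists_norm_pow_mul_toFun_le (σ₁ σ₂ : ℝ) :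
    ∃ C A : ℝ, 0 < C ∧ 0 ≤ A ∧ ∀ s : ℂ, σ₁ ≤ s.re → s.re ≤ σ₂ → s ≠ 1 →
      ‖(s - 1) ^ D.polarOrder * D.toFun s‖ ≤ C * (1 + |s.im|) ^ A := by
  obtain ⟨κ₀, hκ₀2, hline⟩ := D.exists_norm_toFun_left_line_le
  obtain ⟨κ, hκκ₀, hκ3, hσ₁, hσ₂⟩ : ∃ κ : ℝ, κ₀ ≤ κ ∧ 3 ≤ κ ∧ 1 - κ ≤ σ₁ ∧ σ₂ ≤ κ := by
    refine ⟨max κ₀ (max (1 - σ₁) σ₂) + 1, ?_, ?_, ?_, ?_⟩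
    · linarith [le_max_left κ₀ (max (1 - σ₁) σ₂)]
    · linarith [le_max_left κ₀ (max (1 - σ₁) σ₂)]
    · linarith [le_max_left (1 - σ₁) σ₂, le_max_right κ₀ (max (1 - σ₁) σ₂)]
    · linarith [le_max_right (1 - σ₁) σ₂, le_max_right κ₀ (max (1 - σ₁) σ₂)]
  obtain ⟨C₁, A₁, hC₁, hA₁, hleft⟩ := hline κ hκκ₀
  obtain ⟨A₀, hA₀, hright⟩ := D.exists_norm_toFun_le_of_re_ge
  obtain ⟨G, hG, hGF, -⟩ := D.differentiable
  obtain ⟨Af, Bf, hfin⟩ := D.finiteOrder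
  have hab : 1 - κ < κ := by linarith
  -- `‖κ + z‖ ≥ 1` and `|z - 1| ≤ (κ+2) ‖κ + z‖` on the closed strip
  have hQz : ∀ z : ℂ, 1 - κ ≤ z.re → 1 ≤ ‖(κ : ℂ) + z‖ := fun z hz ↦ by
    have : ((κ : ℂ) + z).re = κ + z.re := by simp
    calc (1 : ℝ) ≤ κ + z.re := by linarith
      _ = |((κ : ℂ) + z).re| := by rw [this, abs_of_nonneg (by linarith)]
      _ ≤ ‖(κ : ℂ) + z‖ := Complex.abs_re_le_norm _
  have hz1 : ∀ z : ℂ, 1 - κ ≤ z.re → ‖z - 1‖ ≤ (κ + 2) * ‖(κ : ℂ) + z‖ := fun z hz ↦ by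
    have h1 := hQz z hz
    have hk1 : ‖((κ : ℂ) + 1 : ℂ)‖ = κ + 1 := by
      rw [show ((κ : ℂ) + 1 : ℂ) = ((κ + 1 : ℝ) : ℂ) by push_cast; ring, Complex.norm_real,
        Real.norm_of_nonneg (by linarith)]
    calc ‖z - 1‖ = ‖((κ : ℂ) + z) - ((κ : ℂ) + 1)‖ := by ring_nf
      _ ≤ ‖(κ : ℂ) + z‖ + ‖((κ : ℂ) + 1 : ℂ)‖ := norm_sub_le _ _
      _ = ‖(κ : ℂ) + z‖ + (κ + 1) := by rw [hk1]
      _ ≤ (κ + 2) * ‖(κ : ℂ) + z‖ := by nlinarith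
  -- (1) left edge
  have hleft' : ∀ z : ℂ, z.re = 1 - κ →
      ‖G z‖ ≤ (C₁ * 2 ^ A₁ * (κ + 2) ^ D.polarOrder) * ‖(κ : ℂ) + z‖ ^ ((D.polarOrder : ℝ) + A₁) := by
    intro z hz
    have hzne : z ≠ 1 := by
      intro h; rw [h, Complex.one_re] at hz; linarith
    have hzeq : z = ((1 - κ : ℝ) : ℂ) + z.im * I := by
      apply Complex.ext <;> simp [hz]
    have hF : ‖D.toFun z‖ ≤ C₁ * (1 + |z.im|) ^ A₁ := by
      have := hleft z.im; rwa [← hzeq] at this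
    have hQ1 := hQz z hz.ge
    have hQ0 : 0 < ‖(κ : ℂ) + z‖ := by linarith
    have ht : 1 + |z.im| ≤ 2 * ‖(κ : ℂ) + z‖ := by
      have : |z.im| ≤ ‖(κ : ℂ) + z‖ := by
        have := Complex.abs_im_le_norm ((κ : ℂ) + z); simpa using this
      linarith
    rw [hGF z hzne, norm_mul, norm_pow]
    calc ‖z - 1‖ ^ D.polarOrder * ‖D.toFun z‖
        ≤ ((κ + 2) * ‖(κ : ℂ) + z‖) ^ D.polarOrder * (C₁ * (1 + |z.im|) ^ A₁) := by
          gcongr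
          exact hz1 z hz.ge
      _ ≤ ((κ + 2) * ‖(κ : ℂ) + z‖) ^ D.polarOrder * (C₁ * (2 * ‖(κ : ℂ) + z‖) ^ A₁) := by
          gcongr
      _ = (C₁ * 2 ^ A₁ * (κ + 2) ^ D.polarOrder) *
            (‖(κ : ℂ) + z‖ ^ (D.polarOrder : ℝ) * ‖(κ : ℂ) + z‖ ^ A₁) := by
          rw [mul_pow, Real.mul_rpow zero_le_two hQ0.le, Real.rpow_natCast]; ring
      _ = (C₁ * 2 ^ A₁ * (κ + 2) ^ D.polarOrder) * ‖(κ : ℂ) + z‖ ^ ((D.polarOrder : ℝ) + A₁) := by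
          rw [← Real.rpow_add hQ0]
  -- (2) right edge
  have hright' : ∀ z : ℂ, z.re = κ →
      ‖G z‖ ≤ (A₀ * (κ + 2) ^ D.polarOrder) * ‖(κ : ℂ) + z‖ ^ (D.polarOrder : ℝ) := by
    intro z hz
    have hzne : z ≠ 1 := by
      intro h; rw [h, Complex.one_re] at hz; linarith
    have hF : ‖D.toFun z‖ ≤ A₀ := hright z (by rw [hz]; linarith)
    rw [hGF z hzne, norm_mul, norm_pow, Real.rpow_natCast]
    calc ‖z - 1‖ ^ D.polarOrder * ‖D.toFun z‖ ≤ ((κ + 2) * ‖(κ : ℂ) + z‖) ^ D.polarOrder * A₀ := by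
          gcongr
          exact hz1 z (by rw [hz]; linarith)
      _ = (A₀ * (κ + 2) ^ D.polarOrder) * ‖(κ : ℂ) + z‖ ^ D.polarOrder := by rw [mul_pow]; ring
  -- (3) finite order inside the strip
  have hK : IsCompact (Icc (-κ) κ ×ℂ Icc (-(max κ ((2 : ℝ) ^ (max Bf 1)))) (max κ ((2 : ℝ) ^ (max Bf 1)))) :=
    isCompact_Icc.reProdIm isCompact_Icc
  obtain ⟨M₁, hM₁⟩ := hK.exists_bound_of_continuousOn hG.continuous.continuousOn
  have hgr : ∀ z : ℂ, 1 - κ < z.re → z.re < κ →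
      ‖G z‖ ≤ (|M₁| + |Af| + 1) * Real.exp (|z.im| ^ (max Bf 1 + 1)) := by
    intro z hza hzb
    have hre : |z.re| ≤ κ := abs_le.mpr ⟨by linarith, by linarith⟩
    have hexp1 : 1 ≤ Real.exp (|z.im| ^ (max Bf 1 + 1)) :=
      Real.one_le_exp (Real.rpow_nonneg (abs_nonneg _) _)
    rcases le_or_gt |z.im| (max κ ((2 : ℝ) ^ (max Bf 1))) with hsmall | hlarge
    · -- in the compact box
      have hmem : z ∈ Icc (-κ) κ ×ℂ Icc (-(max κ ((2 : ℝ) ^ (max Bf 1)))) (max κ ((2 : ℝ) ^ (max Bf 1))) :=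
        ⟨abs_le.mp hre, abs_le.mp hsmall⟩
      calc ‖G z‖ ≤ M₁ := hM₁ z hmem
        _ ≤ (|M₁| + |Af| + 1) * 1 := by linarith [le_abs_self M₁, abs_nonneg Af]
        _ ≤ (|M₁| + |Af| + 1) * Real.exp (|z.im| ^ (max Bf 1 + 1)) :=
            mul_le_mul_of_nonneg_left hexp1 (by positivity)
    · -- far up: finite order, `‖z‖^Bf ≤ |im z|^(B'+1)`
      have hzne : z ≠ 1 := by
        intro h; rw [h, Complex.one_im, abs_zero] at hlarge
        linarith [le_max_left κ ((2 : ℝ) ^ (max Bf 1))]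
      have hpow := SelbergDatum.norm_rpow_le_abs_im_rpow (B := Bf) (by linarith) hre (le_max_left _ _)
        (le_max_right _ _) hlarge.le
      calc ‖G z‖ = ‖(z - 1) ^ D.polarOrder * D.toFun z‖ := by rw [hGF z hzne]
        _ ≤ Af * Real.exp (‖z‖ ^ Bf) := hfin z hzne
        _ ≤ |Af| * Real.exp (‖z‖ ^ Bf) :=
            mul_le_mul_of_nonneg_right (le_abs_self Af) (Real.exp_pos _).le
        _ ≤ |Af| * Real.exp (|z.im| ^ (max Bf 1 + 1)) :=
            mul_le_mul_of_nonneg_left (Real.exp_le_exp.mpr hpow) (abs_nonneg Af)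
        _ ≤ (|M₁| + |Af| + 1) * Real.exp (|z.im| ^ (max Bf 1 + 1)) := by
            apply mul_le_mul_of_nonneg_right _ (Real.exp_pos _).le
            linarith [abs_nonneg M₁]
  -- Rademacher
  have hAℓ0 : 0 < C₁ * 2 ^ A₁ * (κ + 2) ^ D.polarOrder := by positivity
  have hBr0 : 0 < A₀ * (κ + 2) ^ D.polarOrder := by positivity
  have hRad := fun (z : ℂ) (hza : 1 - κ ≤ z.re) (hzb : z.re ≤ κ) ↦
    rademacher_phragmenLindelof_of_finiteOrder (f := G) (Q := κ) hab (by linarith) hAℓ0 hBr0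
      (by linarith : (D.polarOrder : ℝ) ≤ (D.polarOrder : ℝ) + A₁) hG.diffContOnCl
      (by linarith [le_max_right Bf 1] : (0 : ℝ) < max Bf 1 + 1) hgr hleft' hright' hza hzb
  -- the constant
  set M' : ℝ := max (C₁ * 2 ^ A₁ * (κ + 2) ^ D.polarOrder) (A₀ * (κ + 2) ^ D.polarOrder) with hM'
  set α : ℝ := (D.polarOrder : ℝ) + A₁ with hα
  have hM'0 : 0 < M' := lt_max_of_lt_left hAℓ0
  have hα0 : 0 ≤ α := by rw [hα]; positivity
  refine ⟨M' * (2 * κ) ^ α, α, by positivity, hα0, fun s hs₁ hs₂ hs1 ↦ ?_⟩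
  have hsa : 1 - κ ≤ s.re := hσ₁.trans hs₁
  have hsb : s.re ≤ κ := hs₂.trans hσ₂
  have h := hRad s hsa hsb
  have hQ1 := hQz s hsa
  have hQ0 : 0 < ‖(κ : ℂ) + s‖ := by linarith
  -- both factors are at most `M' ‖κ+s‖^α`
  have hθ0 : 0 ≤ (κ - s.re) / (κ - (1 - κ)) := div_nonneg (by linarith) (by linarith)
  have hθ1 : 0 ≤ (s.re - (1 - κ)) / (κ - (1 - κ)) := div_nonneg (by linarith) (by linarith)
  have hθsum : (κ - s.re) / (κ - (1 - κ)) + (s.re - (1 - κ)) / (κ - (1 - κ)) = 1 := by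
    rw [← add_div, div_eq_one_iff_eq (by linarith)]; ring
  have hX : C₁ * 2 ^ A₁ * (κ + 2) ^ D.polarOrder * ‖(κ : ℂ) + s‖ ^ α ≤ M' * ‖(κ : ℂ) + s‖ ^ α :=
    mul_le_mul_of_nonneg_right (le_max_left _ _) (Real.rpow_nonneg hQ0.le _)
  have hY : A₀ * (κ + 2) ^ D.polarOrder * ‖(κ : ℂ) + s‖ ^ (D.polarOrder : ℝ) ≤ M' * ‖(κ : ℂ) + s‖ ^ α :=
    mul_le_mul (le_max_right _ _) (Real.rpow_le_rpow_of_exponent_le hQ1 (by rw [hα]; linarith))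
      (Real.rpow_nonneg hQ0.le _) hM'0.le
  have hMQ : 0 < M' * ‖(κ : ℂ) + s‖ ^ α := mul_pos hM'0 (Real.rpow_pos_of_pos hQ0 _)
  have hprod : (C₁ * 2 ^ A₁ * (κ + 2) ^ D.polarOrder * ‖(κ : ℂ) + s‖ ^ α) ^ ((κ - s.re) / (κ - (1 - κ))) *
      (A₀ * (κ + 2) ^ D.polarOrder * ‖(κ : ℂ) + s‖ ^ (D.polarOrder : ℝ)) ^ ((s.re - (1 - κ)) / (κ - (1 - κ)))
        ≤ M' * ‖(κ : ℂ) + s‖ ^ α := by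
    have h1 := Real.rpow_le_rpow (by positivity) hX hθ0
    have h2 := Real.rpow_le_rpow (by positivity) hY hθ1
    refine (mul_le_mul h1 h2 (Real.rpow_nonneg (by positivity) _) (Real.rpow_nonneg hMQ.le _)).trans_eq ?_
    rw [← Real.rpow_add hMQ, hθsum, Real.rpow_one]
  -- `‖κ + s‖ ≤ 2κ (1 + |im s|)`
  have hQle : ‖(κ : ℂ) + s‖ ≤ 2 * κ * (1 + |s.im|) := by
    have hre : ((κ : ℂ) + s).re = κ + s.re := by simp
    have him : ((κ : ℂ) + s).im = s.im := by simp
    calc ‖(κ : ℂ) + s‖ ≤ |((κ : ℂ) + s).re| + |((κ : ℂ) + s).im| := Complex.norm_le_abs_re_add_abs_im _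
      _ = |κ + s.re| + |s.im| := by rw [hre, him]
      _ ≤ 2 * κ + |s.im| := by rw [abs_of_nonneg (by linarith)]; linarith
      _ ≤ 2 * κ * (1 + |s.im|) := by nlinarith [abs_nonneg s.im]
  rw [← hGF s hs1]
  calc ‖G s‖ ≤ _ := h
    _ ≤ M' * ‖(κ : ℂ) + s‖ ^ α := hprod
    _ ≤ M' * (2 * κ * (1 + |s.im|)) ^ α :=
        mul_le_mul_of_nonneg_left (Real.rpow_le_rpow hQ0.le hQle hα0) hM'0.le
    _ = M' * (2 * κ) ^ α * (1 + |s.im|) ^ α := by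
        rw [Real.mul_rpow (by linarith) (by linarith [abs_nonneg s.im])]; ring


/-- `F` is bounded on the half-plane `Re s ≥ 3/2` (absolute convergence of the Dirichlet series,
axiom (i)). [cite: Dobner2021, §2 (i) p. 5] -/
theorem bddAbove_norm_toFun_image_re_ge :
    BddAbove ((fun s : ℂ ↦ ‖D.toFun s‖) '' {s : ℂ | 3 / 2 ≤ s.re}) := by
  obtain ⟨A₀, -, hA₀⟩ := D.exists_norm_toFun_le_of_re_ge
  refine ⟨A₀, ?_⟩
  rintro _ ⟨s, hs, rfl⟩
  exact hA₀ s hs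

/-- **Polynomial growth in vertical strips for `𝒮♯`** (the convexity bound in its printed form,
Kaczorowski–Perelli 1999, §2: "`F(σ + it) ≪ |t|^c` for `|t| ≥ 1`, uniformly in `σ₁ ≤ σ ≤ σ₂`"): for
all `σ₁, σ₂` there are `C > 0`, `A ≥ 0` with `‖F(s)‖ ≤ C |Im s|^A` whenever `σ₁ ≤ Re s ≤ σ₂` and
`|Im s| ≥ 1`. From the Phragmén–Lindelöf bound for `(s−1)ᵐ F(s)` and `‖s − 1‖ ≥ |Im s| ≥ 1`.
[cite: KaczorowskiPerelli1999, §2] -/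
theorem norm_toFun_le_mul_abs_im_rpow (σ₁ σ₂ : ℝ) :
    ∃ C A : ℝ, 0 < C ∧ 0 ≤ A ∧ ∀ s : ℂ, σ₁ ≤ s.re → s.re ≤ σ₂ → 1 ≤ |s.im| →
      ‖D.toFun s‖ ≤ C * |s.im| ^ A := by
  obtain ⟨C, A, hC, hA, h⟩ := D.exists_norm_pow_mul_toFun_le σ₁ σ₂
  refine ⟨C * 2 ^ A, A, by positivity, hA, fun s hs₁ hs₂ ht ↦ ?_⟩
  have hs1 : s ≠ 1 := by
    intro h1; rw [h1, Complex.one_im, abs_zero] at ht; exact absurd ht (by norm_num)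
  have hb := h s hs₁ hs₂ hs1
  rw [norm_mul, norm_pow] at hb
  have him : |s.im| ≤ ‖s - 1‖ := by
    have := Complex.abs_im_le_norm (s - 1); simpa using this
  have h1 : 1 ≤ ‖s - 1‖ ^ D.polarOrder := one_le_pow₀ (ht.trans him)
  have ht0 : 0 < |s.im| := lt_of_lt_of_le one_pos ht
  have h2 : ‖D.toFun s‖ ≤ C * (1 + |s.im|) ^ A := by
    have h3 : ‖D.toFun s‖ ≤ ‖s - 1‖ ^ D.polarOrder * ‖D.toFun s‖ :=
      le_mul_of_one_le_left (norm_nonneg _) h1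
    exact h3.trans hb
  have h4 : (1 + |s.im|) ^ A ≤ (2 * |s.im|) ^ A :=
    Real.rpow_le_rpow (by positivity) (by linarith) hA
  calc ‖D.toFun s‖ ≤ C * (1 + |s.im|) ^ A := h2
    _ ≤ C * (2 * |s.im|) ^ A := mul_le_mul_of_nonneg_left h4 hC.le
    _ = C * 2 ^ A * |s.im| ^ A := by rw [Real.mul_rpow zero_le_two ht0.le]; ring

/-- **The convexity bound through the pole** (`𝒮♯`): for all `σ₁ ≤ σ₂` there are `C > 0`, `A ≥ 0`
with `‖F(s)‖ · ‖s − 1‖ᵐ ≤ C (1 + |Im s|)^A` on `σ₁ ≤ Re s ≤ σ₂`, `s ≠ 1` (`m` the polar order;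
Rademacher–Phragmén–Lindelöf for the entire finite-order function `(s−1)ᵐ F(s)` between a far-left
line, where the functional equation gives polynomial growth, and a line of absolute convergence).
[cite: KaczorowskiPerelli1999, §2] -/
theorem norm_toFun_mul_norm_sub_one_pow_le (σ₁ σ₂ : ℝ) :
    ∃ C A : ℝ, 0 < C ∧ 0 ≤ A ∧ ∀ s : ℂ, σ₁ ≤ s.re → s.re ≤ σ₂ → s ≠ 1 →
      ‖D.toFun s‖ * ‖s - 1‖ ^ D.polarOrder ≤ C * (1 + |s.im|) ^ A := by
  obtain ⟨C, A, hC, hA, h⟩ := D.exists_norm_pow_mul_toFun_le σ₁ σ₂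
  refine ⟨C, A, hC, hA, fun s hs₁ hs₂ hs1 ↦ ?_⟩
  have hb := h s hs₁ hs₂ hs1
  rwa [norm_mul, norm_pow, mul_comm] at hb


/-! ## Eq. (3.1) for `𝒮♯`: `ξ^F_t` as a Gaussian average of `ξ^F` over the line `Re w = 2` -/

section ThreeOne

open MeasureTheory

/-- `∫ e^{−b|x|} dx < ∞` for `b > 0`. [folklore] -/
private theorem integrable_exp_neg_mul_abs {b : ℝ} (hb : 0 < b) :
    Integrable fun ξ : ℝ ↦ Real.exp (-b * |ξ|) := by
  have h1 : IntegrableOn (fun ξ : ℝ ↦ Real.exp (-b * |ξ|)) (Set.Ioi 0) := by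
    refine (integrableOn_exp_mul_Ioi (by linarith : -b < 0) 0).congr_fun (fun ξ hξ ↦ ?_)
      measurableSet_Ioi
    rw [abs_of_pos hξ]
  have h2 : IntegrableOn (fun ξ : ℝ ↦ Real.exp (-b * |ξ|)) (Set.Iic 0) := by
    refine (integrableOn_exp_mul_Iic hb 0).congr_fun (fun ξ hξ ↦ ?_) measurableSet_Iic
    rw [abs_of_nonpos hξ]; ring_nf
  have := h2.union h1
  rwa [Set.Iic_union_Ioi, integrableOn_univ] at this

/-- **Exponential decay of `ξ^F` in the strip `½ ≤ Re s ≤ 2`** (`k ≥ 1`): there are `M, K > 0`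
with `‖ξ^F(s)‖ ≤ M e^{−K|Im s|}` for `½ ≤ Re s ≤ 2`, `s ≠ 1` — Dobner's Lemma 1 (`|γ(s)| ≤ e^{−K|Im s|}`
for `|Im s| ≥ T₀`, `|Re s| ≤ 2`) times the polynomial growth of `F` in the strip
(`norm_toFun_le_mul_abs_im_rpow`), and continuity of the entire `ξ^F` on the remaining compact
box (p. 6: "`ξ^F(½ + ix)` decays exponentially", via Lemma 1). [cite: Dobner2021, §2 p. 6] -/
theorem exists_norm_xi_le_exp_neg (hk : 0 < D.numGamma) :
    ∃ M K : ℝ, 0 < M ∧ 0 < K ∧ ∀ s : ℂ, 1 / 2 ≤ s.re → s.re ≤ 2 → s ≠ 1 →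
      ‖D.xi s‖ ≤ M * Real.exp (-(K * |s.im|)) := by
  obtain ⟨Ξ, hΞd, hΞxi, -⟩ := D.exists_entire_xi
  obtain ⟨K, K', T₀, hK, -, hγ⟩ := dobner_lemma1_holds D.alpha D.polarOrder D.Q D.numGamma D.omega
    D.mu D.alpha_ne_zero D.Q_pos hk D.omega_pos D.mu_re_nonneg 2 0 two_pos le_rfl one_pos
  obtain ⟨C, A, hC, -, hF⟩ := D.norm_toFun_le_mul_abs_im_rpow (1 / 2) 2
  -- `T^A e^{−(K/2)T} ≤ 1` for `T ≥ T₂`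
  have hlim := tendsto_rpow_mul_exp_neg_mul_atTop_nhds_zero A (K / 2) (by positivity)
  obtain ⟨T₂, hT₂⟩ := eventually_atTop.1 (hlim.eventually (eventually_le_nhds one_pos))
  set T₃ : ℝ := max (max T₀ 1) T₂ with hT₃
  -- the compact box `[½, 2] × [−T₃, T₃]`
  have hcpt : IsCompact (Icc (1 / 2 : ℝ) 2 ×ℂ Icc (-T₃) T₃) := isCompact_Icc.reProdIm isCompact_Icc
  obtain ⟨M₁, hM₁⟩ := hcpt.exists_bound_of_continuousOn hΞd.continuous.continuousOn
  refine ⟨max C ((|M₁| + 1) * Real.exp (K / 2 * T₃)), K / 2, lt_max_of_lt_left hC, by positivity,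
    fun s hs₁ hs₂ hs1 ↦ ?_⟩
  rcases le_or_gt T₃ |s.im| with hlarge | hsmall
  · -- large `|Im s|`: Lemma 1 × convexity bound
    have hT₀ : T₀ ≤ |s.im| := le_trans ((le_max_left _ _).trans (le_max_left _ _)) hlarge
    have h1 : 1 ≤ |s.im| := le_trans ((le_max_right _ _).trans (le_max_left _ _)) hlarge
    have hT₂' : T₂ ≤ |s.im| := le_trans (le_max_right _ _) hlarge
    have hγs := (hγ s (by rw [Real.rpow_zero, mul_one]; exact abs_le.2 ⟨by linarith, by linarith⟩)
      hT₀).2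
    have hFs := hF s hs₁ hs₂ h1
    have hpoly : |s.im| ^ A * Real.exp (-(K / 2) * |s.im|) ≤ 1 := hT₂ _ hT₂'
    rw [xi_apply, norm_mul]
    have hsplit : Real.exp (-(K * |s.im|)) =
        Real.exp (-(K / 2) * |s.im|) * Real.exp (-(K / 2 * |s.im|)) := by
      rw [← Real.exp_add]; congr 1; ring
    calc ‖D.gamma s‖ * ‖D.toFun s‖ ≤ Real.exp (-(K * |s.im|)) * (C * |s.im| ^ A) :=
          mul_le_mul hγs hFs (norm_nonneg _) (Real.exp_pos _).le
      _ = C * (|s.im| ^ A * Real.exp (-(K / 2) * |s.im|)) * Real.exp (-(K / 2 * |s.im|)) := by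
          rw [hsplit]; ring
      _ ≤ C * 1 * Real.exp (-(K / 2 * |s.im|)) := by gcongr
      _ ≤ max C ((|M₁| + 1) * Real.exp (K / 2 * T₃)) * Real.exp (-(K / 2 * |s.im|)) := by
          rw [mul_one]; gcongr; exact le_max_left _ _
  · -- small `|Im s|`: the entire `ξ^F` is bounded on the box
    have hmem : s ∈ Icc (1 / 2 : ℝ) 2 ×ℂ Icc (-T₃) T₃ := ⟨⟨hs₁, hs₂⟩, abs_le.1 hsmall.le⟩
    have hΞs : ‖Ξ s‖ ≤ M₁ := hM₁ s hmem
    rw [← hΞxi s (by linarith) hs1]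
    have hexp : 1 ≤ Real.exp (K / 2 * T₃) * Real.exp (-(K / 2 * |s.im|)) := by
      rw [← Real.exp_add]
      exact Real.one_le_exp (by nlinarith [abs_nonneg s.im])
    calc ‖Ξ s‖ ≤ |M₁| + 1 := hΞs.trans (by linarith [le_abs_self M₁])
      _ ≤ (|M₁| + 1) * (Real.exp (K / 2 * T₃) * Real.exp (-(K / 2 * |s.im|))) :=
          le_mul_of_one_le_right (by positivity) hexp
      _ = (|M₁| + 1) * Real.exp (K / 2 * T₃) * Real.exp (-(K / 2 * |s.im|)) := by ring
      _ ≤ max C ((|M₁| + 1) * Real.exp (K / 2 * T₃)) * Real.exp (-(K / 2 * |s.im|)) := by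
          gcongr; exact le_max_right _ _

/-- The point `(1 + ix)/2` of the critical line. [cite: Dobner2021, §2 p. 5] -/
private theorem critical_pt_eq (x : ℝ) :
    (1 + I * x) / 2 = ((1 / 2 : ℝ) : ℂ) + ((x / 2 : ℝ) : ℂ) * I := by
  push_cast; ring

/-- `x ↦ ξ^F((1+ix)/2)` is continuous (it is the entire `ξ^F` along the critical line).
[cite: Dobner2021, §2 p. 5] -/
theorem continuous_xi_critical_line : Continuous fun x : ℝ ↦ D.xi ((1 + I * x) / 2) := by
  obtain ⟨Ξ, hΞd, hΞxi, -⟩ := D.exists_entire_xi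
  have heq : (fun x : ℝ ↦ D.xi ((1 + I * x) / 2)) = fun x : ℝ ↦ Ξ ((1 + I * x) / 2) := by
    funext x
    refine (hΞxi _ ?_ ?_).symm
    · rw [critical_pt_eq]; simp
    · intro h
      have := congrArg Complex.re h
      rw [critical_pt_eq] at this
      norm_num at this
  rw [heq]
  exact hΞd.continuous.comp (by fun_prop)

/-- **`ξ^F(½ + ix)` decays exponentially** (p. 6; `k ≥ 1`): `‖ξ^F((1+ix)/2)‖ ≤ M e^{−K|x|}`.
[cite: Dobner2021, §2 p. 6] -/
theorem exists_norm_xi_critical_line_le (hk : 0 < D.numGamma) :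
    ∃ M K : ℝ, 0 < M ∧ 0 < K ∧ ∀ x : ℝ, ‖D.xi ((1 + I * x) / 2)‖ ≤ M * Real.exp (-(K * |x|)) := by
  obtain ⟨M, K, hM, hK, h⟩ := D.exists_norm_xi_le_exp_neg hk
  refine ⟨M, K / 2, hM, by positivity, fun x ↦ ?_⟩
  have h1 := h ((1 + I * x) / 2) (by rw [critical_pt_eq]; simp) (by rw [critical_pt_eq]; simp; norm_num)
    (by
      intro h
      have := congrArg Complex.re h
      rw [critical_pt_eq] at this
      norm_num at this)
  have him : (((1 + I * x) / 2 : ℂ)).im = x / 2 := by rw [critical_pt_eq]; simp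
  rw [him, abs_div, abs_two] at h1
  convert h1 using 3
  ring

/-- `x ↦ ξ^F((1+ix)/2)` is integrable over `ℝ` (`k ≥ 1`), so that `Φ_F` is a genuine Fourier
transform (p. 6: "the integrand decays exponentially"). [cite: Dobner2021, §2 p. 6] -/
theorem integrable_xi_critical_line (hk : 0 < D.numGamma) :
    Integrable fun x : ℝ ↦ D.xi ((1 + I * x) / 2) := by
  obtain ⟨M, K, hM, hK, h⟩ := D.exists_norm_xi_critical_line_le hk
  refine ((integrable_exp_neg_mul_abs hK).const_mul M).mono'
    D.continuous_xi_critical_line.aestronglyMeasurable (Eventually.of_forall fun x ↦ ?_)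
  rw [neg_mul]
  exact h x

/-- **`H_t` as a Gaussian average of `ξ^F` on the critical line** (`t < 0`, `k ≥ 1`): inserting
the definition of `Φ_F` into `H_t(z) = ∫ e^{tu²} Φ_F(u) e^{izu} du` and interchanging (Fubini: the
double integrand is dominated by `e^{tu² − (Im z)u} |ξ^F((1+ix)/2)|`), the inner Gaussian Fourier
integral `∫ e^{tu² + i(z−x)u} du = √(π/|t|) e^{−(z−x)²/(4|t|)}` gives
`H_t(z) = (√(π/|t|)/(2π)) ∫_ℝ ξ^F((1+ix)/2) e^{−(z−x)²/(4|t|)} dx` — the rotated form of eq. (3.1).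
[cite: Dobner2021, §3 eq. (3.1) p. 8] -/
theorem Ht_eq_integral_xi_gaussian (hk : 0 < D.numGamma) {t : ℝ} (ht : t < 0) (z : ℂ) :
    D.Ht t z = ((Real.sqrt (Real.pi / |t|) / (2 * Real.pi) : ℝ) : ℂ) *
      ∫ x : ℝ, D.xi ((1 + I * x) / 2) * cexp (-(z - x) ^ 2 / (4 * |t|)) := by
  have hΞc := D.continuous_xi_critical_line
  have hΞi := D.integrable_xi_critical_line hk
  have ht' : 0 < |t| := abs_pos.2 ht.ne
  have htabs : |t| = -t := abs_of_neg ht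
  -- the double integrand
  set f : ℝ → ℝ → ℂ := fun u x ↦ cexp ((t : ℂ) * u ^ 2 + I * (z - x) * u) *
    ((1 / (2 * Real.pi) : ℂ) * D.xi ((1 + I * x) / 2)) with hf
  have hfx : ∀ u x : ℝ, f u x = (((Real.exp (t * u ^ 2) : ℝ) : ℂ) * (1 / (2 * Real.pi) : ℂ) *
      cexp (I * z * u)) * (D.xi ((1 + I * x) / 2) * cexp (-(I * x * u))) := by
    intro u x
    simp only [hf]
    rw [Complex.ofReal_exp]
    have e : cexp ((t : ℂ) * u ^ 2 + I * (z - x) * u) =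
        cexp (((t * u ^ 2 : ℝ) : ℂ)) * cexp (I * z * u) * cexp (-(I * x * u)) := by
      rw [← Complex.exp_add, ← Complex.exp_add]
      congr 1
      push_cast
      ring
    rw [e]
    ring
  -- (a) the `H_t`-integrand is the inner integral of `f`
  have ha : ∀ u : ℝ, ((Real.exp (t * u ^ 2) : ℝ) : ℂ) * D.Phi u * cexp (I * z * u) =
      ∫ x : ℝ, f u x := by
    intro u
    rw [show (fun x : ℝ ↦ f u x) = fun x : ℝ ↦ (((Real.exp (t * u ^ 2) : ℝ) : ℂ) *
        (1 / (2 * Real.pi) : ℂ) * cexp (I * z * u)) * (D.xi ((1 + I * x) / 2) * cexp (-(I * x * u)))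
        from funext (hfx u), integral_const_mul, Phi]
    ring
  -- (b) integrability of the double integrand
  have hu : Integrable fun u : ℝ ↦ cexp ((t : ℂ) * u ^ 2 + I * z * u) := by
    have := integrable_cexp_quadratic (b := -(t : ℂ)) (by simp; linarith) (I * z) 0
    refine this.congr (Eventually.of_forall fun u ↦ ?_)
    simp
  have hint : Integrable (Function.uncurry f) (volume.prod volume) := by
    have hG : Integrable (fun p : ℝ × ℝ ↦ ‖cexp ((t : ℂ) * p.1 ^ 2 + I * z * p.1)‖ *
        ((1 / (2 * Real.pi)) * ‖D.xi ((1 + I * p.2) / 2)‖)) (volume.prod volume) :=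
      hu.norm.mul_prod (hΞi.norm.const_mul _)
    refine hG.mono' ?_ (Eventually.of_forall fun p ↦ le_of_eq ?_)
    · refine Continuous.aestronglyMeasurable ?_
      simp only [hf, Function.uncurry_def]
      exact (Complex.continuous_exp.comp (by fun_prop)).mul
        (continuous_const.mul (hΞc.comp continuous_snd))
    · obtain ⟨u, x⟩ := p
      have hre : ((t : ℂ) * u ^ 2 + I * (z - x) * u).re = ((t : ℂ) * u ^ 2 + I * z * u).re := by
        simp [Complex.mul_re, Complex.mul_im, sub_mul, mul_sub]
      have hc : ‖(1 / (2 * Real.pi) : ℂ)‖ = 1 / (2 * Real.pi) := by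
        rw [show (1 / (2 * Real.pi) : ℂ) = ((1 / (2 * Real.pi) : ℝ) : ℂ) by push_cast; ring,
          Complex.norm_real, Real.norm_of_nonneg (by positivity)]
      simp only [Function.uncurry_apply_pair, hf, norm_mul, Complex.norm_exp, hre, hc]
  -- (c) Fubini
  rw [Ht, Literature.Analysis.Complex.trigIntegral]
  rw [show (fun u : ℝ ↦ ((Real.exp (t * u ^ 2) : ℝ) : ℂ) * D.Phi u * cexp (I * z * u)) =
      fun u : ℝ ↦ ∫ x : ℝ, f u x from funext ha, integral_integral_swap hint]
  -- (d) the inner Gaussian integral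
  have hd : ∀ x : ℝ, ∫ u : ℝ, f u x = ((Real.sqrt (Real.pi / |t|) : ℝ) : ℂ) *
      cexp (-(z - x) ^ 2 / (4 * |t|)) * ((1 / (2 * Real.pi) : ℂ) * D.xi ((1 + I * x) / 2)) := by
    intro x
    simp only [hf]
    rw [integral_mul_const]
    congr 1
    have hq := integral_cexp_quadratic (b := (t : ℂ)) (by simp [ht]) (I * (z - x)) 0
    simp only [add_zero] at hq
    rw [hq]
    congr 1
    · rw [show -(t : ℂ) = ((|t| : ℝ) : ℂ) by rw [htabs]; push_cast; ring,
        show (1 / 2 : ℂ) = ((1 / 2 : ℝ) : ℂ) by push_cast; ring,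
        show (Real.pi : ℂ) / ((|t| : ℝ) : ℂ) = ((Real.pi / |t| : ℝ) : ℂ) by push_cast; ring,
        ← Complex.ofReal_cpow (by positivity), Real.sqrt_eq_rpow]
    · congr 1
      rw [zero_sub, show (t : ℂ) = -((|t| : ℝ) : ℂ) by rw [htabs]; push_cast; ring]
      have hI : (I * (z - x)) ^ 2 = -(z - x) ^ 2 := by rw [mul_pow, Complex.I_sq]; ring
      rw [hI]
      have h0 : ((|t| : ℝ) : ℂ) ≠ 0 := by exact_mod_cast ht'.ne'
      field_simp
  simp_rw [hd]
  -- (e) constants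
  rw [← integral_const_mul]
  refine integral_congr_ae (Eventually.of_forall fun x ↦ ?_)
  push_cast
  ring

/-- **Eq. (3.1) on the critical line**: for `t < 0` (`k ≥ 1`),
`ξ^F_t(w) = (√(π/|t|)/(2π)) ∫_ℝ ξ^F((1+ix)/2) e^{(w − (1+ix)/2)²/|t|} dx`
(`= (1/(i√(π|t|))) ∫_{Re w' = ½} ξ^F(w') e^{(w−w')²/|t|} dw'`, `dw' = (i/2) dx`), from
`Ht_eq_integral_xi_gaussian` and `ξ^F_t(w) = H_t(−i(2w−1))`. [cite: Dobner2021, §3 eq. (3.1) p. 8] -/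
theorem xiDeformed_eq_integral_xi_critical_line (hk : 0 < D.numGamma) {t : ℝ} (ht : t < 0)
    (w : ℂ) : D.xiDeformed t w = ((Real.sqrt (Real.pi / |t|) / (2 * Real.pi) : ℝ) : ℂ) *
      ∫ x : ℝ, D.xi ((1 + I * x) / 2) *
        cexp (((1 / |t| : ℝ) : ℂ) * (w - (1 + I * x) / 2) ^ 2) := by
  rw [xiDeformed, D.Ht_eq_integral_xi_gaussian hk ht]
  congr 1
  refine integral_congr_ae (Eventually.of_forall fun x ↦ ?_)
  dsimp only
  congr 2
  have ht' : 0 < |t| := abs_pos.2 ht.ne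
  have h0 : ((|t| : ℝ) : ℂ) ≠ 0 := by exact_mod_cast ht'.ne'
  have e1 : (-I * (2 * w - 1) - (x : ℂ)) ^ 2 = -(2 * w - 1) ^ 2 + 2 * I * x * (2 * w - 1) + x ^ 2 := by
    ring_nf; rw [Complex.I_sq]; ring
  have e2 : (w - (1 + I * x) / 2) ^ 2 = ((2 * w - 1) ^ 2 - 2 * I * x * (2 * w - 1) - x ^ 2) / 4 := by
    ring_nf; rw [Complex.I_sq]; ring
  rw [e1, e2]
  push_cast
  field_simp
  ring

/-- **Dobner's eq. (3.1) for the extended Selberg class, on the line `Re w = 2`**: for every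
`F ∈ 𝒮♯` with `k ≥ 1`, every `t < 0` and every `w`,
`ξ^F_t(w) = (π|t|)^{−1/2} ∫_ℝ ξ^F(2 + iv) e^{(w − 2 − iv)²/|t|} dv`
(`= (1/(i√(π|t|))) ∫_{2−i∞}^{2+i∞} ξ^F(w') e^{(w−w')²/|t|} dw'`; "for any real `c`. This follows
from the definition of `ξ^F_t` and the calculus of Fourier transforms", p. 8). The critical-line
form `xiDeformed_eq_integral_xi_critical_line` is shifted to `Re w' = 2` by Cauchy's theorem on
the rectangles `[½, 2] × [−T, T]` (`MertensBoundRH.integral_vertical_eq_of_tendsto`) applied to the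
ENTIRE `ξ^F` of `exists_entire_xi` (equal to the pointwise `D.xi` on both lines), the horizontal
edges tending to `0` by the exponential decay `exists_norm_xi_le_exp_neg`. This is the shape
consumed by the `𝒮♯`-general Theorem 4 (N1-a of the cell's plan). [cite: Dobner2021, §3 eq. (3.1) p. 8] -/
theorem xiDeformed_eq_integral_xi_two (hk : 0 < D.numGamma) {t : ℝ} (ht : t < 0) (w : ℂ) :
    D.xiDeformed t w = ((1 / Real.sqrt (Real.pi * |t|) : ℝ) : ℂ) *
      ∫ v : ℝ, D.xi (2 + v * I) * cexp (((1 / |t| : ℝ) : ℂ) * (w - (2 + v * I)) ^ 2) := by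
  have ht0 : t ≠ 0 := ht.ne
  have ht' : 0 < |t| := abs_pos.2 ht0
  obtain ⟨Ξ, hΞd, hΞxi, -⟩ := D.exists_entire_xi
  obtain ⟨M, K, hM, hK, hdec⟩ := D.exists_norm_xi_le_exp_neg hk
  set G : ℂ → ℂ := fun w' ↦ Ξ w' * cexp (((1 / |t| : ℝ) : ℂ) * (w - w') ^ 2) with hG
  -- the Gaussian factor on the line `Re w' = σ`
  have hgauss : ∀ σ T : ℝ, ‖cexp (((1 / |t| : ℝ) : ℂ) * (w - (σ + T * I)) ^ 2)‖ ≤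
      Real.exp ((w.re - σ) ^ 2 / |t|) := by
    intro σ T
    rw [Complex.norm_exp, Complex.re_ofReal_mul, sq, Complex.mul_re]
    simp only [Complex.sub_re, Complex.sub_im, Complex.add_re, Complex.add_im, Complex.ofReal_re,
      Complex.ofReal_im, Complex.mul_re, Complex.mul_im, Complex.I_re, Complex.I_im, mul_zero,
      mul_one, zero_add, add_zero, sub_zero]
    refine Real.exp_le_exp.2 ?_
    have h0 : 0 ≤ (w.im - T) * (w.im - T) := mul_self_nonneg _
    have h1 : 1 / |t| * ((w.re - σ) * (w.re - σ) - (w.im - T) * (w.im - T)) ≤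
        1 / |t| * ((w.re - σ) * (w.re - σ)) :=
      mul_le_mul_of_nonneg_left (by linarith) (by positivity)
    calc 1 / |t| * ((w.re - σ) * (w.re - σ) - (w.im - T) * (w.im - T))
        ≤ 1 / |t| * ((w.re - σ) * (w.re - σ)) := h1
      _ = (w.re - σ) ^ 2 / |t| := by ring
  -- `G` on the lines of the closed strip (off `w' = 1`)
  have hGle : ∀ σ ∈ Icc (1 / 2 : ℝ) 2, ∀ T : ℝ, ((σ : ℂ) + T * I) ≠ 1 →
      ‖G (σ + T * I)‖ ≤ M * Real.exp ((w.re - σ) ^ 2 / |t|) * Real.exp (-(K * |T|)) := by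
    intro σ hσ T hne
    have hre : ((σ : ℂ) + T * I).re = σ := by simp
    have him : ((σ : ℂ) + T * I).im = T := by simp
    have h1 := hdec ((σ : ℂ) + T * I) (by rw [hre]; exact hσ.1) (by rw [hre]; exact hσ.2) hne
    rw [him] at h1
    simp only [hG, norm_mul]
    rw [hΞxi _ (by rw [hre]; linarith [hσ.1]) hne]
    calc ‖D.xi (σ + T * I)‖ * ‖cexp (((1 / |t| : ℝ) : ℂ) * (w - (σ + T * I)) ^ 2)‖
        ≤ M * Real.exp (-(K * |T|)) * Real.exp ((w.re - σ) ^ 2 / |t|) :=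
          mul_le_mul h1 (hgauss σ T) (norm_nonneg _) (by positivity)
      _ = M * Real.exp ((w.re - σ) ^ 2 / |t|) * Real.exp (-(K * |T|)) := by ring
  have hGcont : Continuous G := (hΞd.mul (by fun_prop)).continuous
  have hGint : ∀ σ : ℝ, σ ∈ Icc (1 / 2 : ℝ) 2 → σ ≠ 1 →
      Integrable fun T : ℝ ↦ G (σ + T * I) := by
    intro σ hσ hσ1
    have hne : ∀ T : ℝ, ((σ : ℂ) + T * I) ≠ 1 := by
      intro T h
      have := congrArg Complex.re h
      simp at this
      exact hσ1 this
    refine (((integrable_exp_neg_mul_abs hK).const_mul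
      (M * Real.exp ((w.re - σ) ^ 2 / |t|))).mono' (hGcont.comp (by fun_prop)).aestronglyMeasurable
      (Eventually.of_forall fun T ↦ ?_))
    have := hGle σ hσ T (hne T)
    rwa [neg_mul]
  -- step 1: the critical-line form as `2 ∫ G(½ + iv) dv` (`x = 2v`)
  have hhalf : (1 / 2 : ℝ) ∈ Icc (1 / 2 : ℝ) 2 := ⟨le_rfl, by norm_num⟩
  have h1 : D.xiDeformed t w = ((Real.sqrt (Real.pi / |t|) / (2 * Real.pi) : ℝ) : ℂ) *
      ((2 : ℝ) • ∫ v : ℝ, G (((1 / 2 : ℝ) : ℂ) + v * I)) := by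
    rw [D.xiDeformed_eq_integral_xi_critical_line hk ht w]
    congr 1
    have e : (fun x : ℝ ↦ D.xi ((1 + I * x) / 2) *
        cexp (((1 / |t| : ℝ) : ℂ) * (w - (1 + I * x) / 2) ^ 2)) =
        fun x : ℝ ↦ (fun v : ℝ ↦ G (((1 / 2 : ℝ) : ℂ) + v * I)) (2⁻¹ * x) := by
      funext x
      have hpt : (1 + I * x) / 2 = ((1 / 2 : ℝ) : ℂ) + ((2⁻¹ * x : ℝ) : ℂ) * I := by
        push_cast; ring
      have hne : ((1 / 2 : ℝ) : ℂ) + ((2⁻¹ * x : ℝ) : ℂ) * I ≠ 1 := by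
        intro h
        have := congrArg Complex.re h
        norm_num at this
      simp only [hG]
      rw [hpt, hΞxi _ (by simp) hne]
    rw [e, Measure.integral_comp_mul_left (fun v : ℝ ↦ G (((1 / 2 : ℝ) : ℂ) + v * I)) 2⁻¹]
    simp
  -- step 2: shift `Re w' = ½ → 2`
  have h2 : ∫ v : ℝ, G (((1 / 2 : ℝ) : ℂ) + v * I) = ∫ v : ℝ, G (((2 : ℝ) : ℂ) + v * I) := by
    refine MertensBoundRH.integral_vertical_eq_of_tendsto G (by norm_num : (1 / 2 : ℝ) ≤ 2)
      ((hΞd.mul (by fun_prop)).differentiableOn) (hGint (1 / 2) hhalf (by norm_num)) (hGint 2 ⟨by norm_num, le_rfl⟩ (by norm_num))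
      fun ε hε ↦ ?_
    -- uniform decay on the horizontal edges
    set B : ℝ := M * Real.exp ((|w.re| + 2) ^ 2 / |t|) with hB
    have hB0 : 0 < B := by positivity
    have hlim : Tendsto (fun T : ℝ ↦ B * Real.exp (-(K * T))) atTop (𝓝 0) := by
      have : Tendsto (fun T : ℝ ↦ -(K * T)) atTop atBot :=
        tendsto_neg_atTop_atBot.comp (tendsto_id.const_mul_atTop hK)
      simpa using (Real.tendsto_exp_atBot.comp this).const_mul B
    obtain ⟨T₀, hT₀⟩ := eventually_atTop.1 (hlim.eventually (gt_mem_nhds hε))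
    refine ⟨max T₀ 1, fun σ hσ T hT ↦ ?_⟩
    have hT1 : 1 ≤ |T| := (le_max_right _ _).trans hT
    have hne : ((σ : ℂ) + T * I) ≠ 1 := by
      intro h
      have := congrArg Complex.im h
      simp at this
      rw [this, abs_zero] at hT1
      exact absurd hT1 (by norm_num)
    have hsq : (w.re - σ) ^ 2 ≤ (|w.re| + 2) ^ 2 := by
      have h3 : |w.re - σ| ≤ |w.re| + 2 := by
        refine (abs_sub _ _).trans ?_
        rw [abs_of_pos (by linarith [hσ.1] : (0 : ℝ) < σ)]
        linarith [hσ.2]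
      calc (w.re - σ) ^ 2 = |w.re - σ| ^ 2 := (sq_abs _).symm
        _ ≤ (|w.re| + 2) ^ 2 := pow_le_pow_left₀ (abs_nonneg _) h3 2
    calc ‖G (σ + T * I)‖ ≤ M * Real.exp ((w.re - σ) ^ 2 / |t|) * Real.exp (-(K * |T|)) :=
          hGle σ hσ T hne
      _ ≤ B * Real.exp (-(K * |T|)) := by
          rw [hB]; gcongr
      _ ≤ B * Real.exp (-(K * max T₀ 1)) := by
          gcongr
      _ ≤ ε := (hT₀ (max T₀ 1) (le_max_left _ _)).le
  -- step 3: assemble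
  rw [h1, h2]
  have h3 : ∫ v : ℝ, G (((2 : ℝ) : ℂ) + v * I) =
      ∫ v : ℝ, D.xi (2 + v * I) * cexp (((1 / |t| : ℝ) : ℂ) * (w - (2 + v * I)) ^ 2) := by
    refine integral_congr_ae (Eventually.of_forall fun v ↦ ?_)
    have hne : ((2 : ℂ) + v * I) ≠ 1 := by
      intro h
      have := congrArg Complex.re h
      simp at this
    simp only [hG]
    rw [show (((2 : ℝ) : ℂ)) = (2 : ℂ) by norm_num, hΞxi _ (by simp) hne]
  rw [h3, Complex.real_smul, ← mul_assoc]
  congr 1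
  have hπ : 0 < Real.sqrt Real.pi := Real.sqrt_pos.2 Real.pi_pos
  have hst : 0 < Real.sqrt |t| := Real.sqrt_pos.2 ht'
  rw [Real.sqrt_div Real.pi_pos.le, Real.sqrt_mul Real.pi_pos.le]
  have hπ' : (Real.sqrt Real.pi : ℂ) ≠ 0 := by exact_mod_cast hπ.ne'
  have hst' : (Real.sqrt |t| : ℂ) ≠ 0 := by exact_mod_cast hst.ne'
  have hpi : (Real.pi : ℂ) ≠ 0 := by exact_mod_cast Real.pi_pos.ne'
  have hsq : (Real.sqrt Real.pi : ℂ) * Real.sqrt Real.pi = Real.pi := by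
    exact_mod_cast Real.mul_self_sqrt Real.pi_pos.le
  push_cast
  field_simp
  linear_combination hsq

/-- **Exponential decay of `ξ^F` on the line `Re w = 2`** (`k ≥ 1`):
`‖ξ^F(2 + iv)‖ ≤ M e^{−K|v|}` (Lemma 1 for `γ`, `F` bounded on `Re s = 2` by (i)).
[cite: Dobner2021, §2 p. 6] -/
theorem exists_norm_xi_two_le_exp (hk : 0 < D.numGamma) :
    ∃ M K : ℝ, 0 < M ∧ 0 < K ∧ ∀ v : ℝ, ‖D.xi (2 + v * I)‖ ≤ M * Real.exp (-(K * |v|)) := by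
  obtain ⟨M, K, hM, hK, h⟩ := D.exists_norm_xi_le_exp_neg hk
  refine ⟨M, K, hM, hK, fun v ↦ ?_⟩
  have hne : ((2 : ℂ) + v * I) ≠ 1 := by
    intro h
    have := congrArg Complex.re h
    simp at this
  have h1 := h (2 + v * I) (by simp; norm_num) (by simp) hne
  simpa using h1

/-- The polynomial line bound on `Re w = 2` in the shape requested by the plan of record
(`∃ C p, ∀ v, ‖ξ^F(2+iv)‖ ≤ C (1+|v|)^p`; here even `p = 0`). [cite: Dobner2021, §2 p. 6] -/
theorem exists_norm_xi_two_le (hk : 0 < D.numGamma) :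
    ∃ C p : ℝ, 0 < C ∧ ∀ v : ℝ, ‖D.xi (2 + v * I)‖ ≤ C * (1 + |v|) ^ p := by
  obtain ⟨M, K, hM, hK, h⟩ := D.exists_norm_xi_two_le_exp hk
  refine ⟨M, 0, hM, fun v ↦ ?_⟩
  rw [Real.rpow_zero, mul_one]
  refine (h v).trans (mul_le_of_le_one_right hM.le ?_)
  rw [Real.exp_le_one_iff]
  have : 0 ≤ K * |v| := by positivity
  linarith

end ThreeOne

end ExtendedSelbergDatum

end Literature.NumberTheory.LFunctions

end
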